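import Summits.AtomisticToContinuum.Crystallization.Theses.FluxTubeKepler

/-!
# Birth skeleton — crux `FluxTubeKepler.KeplerEnergyFloor`

Item `stmt-AtomisticToContinuum-15222` (filed as support, served as crux because `closes` takes it
as a hypothesis; rank 9; route `FluxTubeKepler`, sub-problem `Crystallization`). The crux is the
route's energy BOOKKEEPING step: from the flux-cell Kepler inequality `FluxCellKepler` (a periodic
`P₀`, a radius `R₁` and a local tail credit `τ` with (DOM) `Σ_i S₆,i ≤ Σ_i τ_i` on every finite
injective configuration and (KEPLER) `c·#(non-layered sites) ≤ Σ_i ((1/24) S₁₂,i − (1/12) τ_i) −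
N·e(P₀)` on every `δ`-separated one) and the uniform minimal distance of Lennard-Jones ground
states (`LennardJonesMinimalDistance`, proved in tree), conclude: some periodic `P₀` has
`N·e(P₀) ≤ E(x)` for every LJ ground state `x`, and for all `R, η > 0` some `c > 0` prices the
non-layered sites of every ground state by the excess energy `E(x) − N·e(P₀)`.
Here `S_p,i = siteEnergy (r ↦ r⁻ᵖ) x i = Σ_(k ≠ i) |x_i − x_k|⁻ᵖ` and `E = interactionEnergy
lennardJones`, `lennardJones r = r⁻¹²/12 − r⁻⁶/6` (Blanc–Lewin normalisation, `r₀ = 1`).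

First cut (two named stubs — the two places where the bookkeeping can actually go wrong, kept
apart: the Lennard-Jones-specific constant check, and the `τ`-elimination inside `FluxCellKepler`):

* `stub_energyIdentity` — THE SCALING IDENTITY (the crux's own "why it might fail": a mis-scaled
  constant 1/24, 1/12 vs `siteEnergy` without the 1/2): for every finite configuration `x` of
  `ℝ³`, `E(x) = Σ_i ((1/24) S₁₂,i − (1/12) S₆,i)`. TRUE and provable now (size S/M): double
  counting `2E = Σ_i siteEnergy lennardJones x i` (`two_mul_interactionEnergy`, in tree) and
  linearity of `siteEnergy` in the potential (`Finset.sum_sub_distrib`, `Finset.mul_sum`); no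
  injectivity needed (`V_LJ(0) = 0 = 0⁻¹²/12 − 0⁻⁶/6` by `0⁻¹ = 0`).
* `stub_cellFloor` — THE τ-FREE CELL FLOOR: `FluxCellKepler` implies that ONE periodic `P₀` floors
  the inverse-power functional on all separated configurations with a defect budget — for every
  `δ > 0`, `R > 0`, `η > 0` some `c > 0` has `N·e(P₀) + c·#(non-(R,η)-layered sites) ≤
  Σ_i ((1/24) S₁₂,i − (1/12) S₆,i)` for every injective `δ`-separated `x`. TRUE given the
  hypothesis and provable now (size M): take `(P₀, R₁, τ)` from `FluxCellKepler`; DOM bounds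
  `Σ S₆` ABOVE by `Σ τ` and `S₆` enters with a minus sign, so `Σ((1/24)S₁₂ − (1/12)τ) ≤
  Σ((1/24)S₁₂ − (1/12)S₆)`; KEPLER at `(δ, R, η)` gives the left-hand side. The tail credit `τ`
  and the radius `R₁` are eliminated here and never seen by the assembly.

Assembly `KeplerEnergyFloor_of`: ground states are injective (`IsGroundState.1`) and uniformly
`δ`-separated (`LennardJonesMinimalDistance`); conjunct 1 is stub 2 at `(δ, 1, 1)` with
`c·#(…) ≥ 0` dropped and stub 1 rewriting the right-hand side into `E(x)`; conjunct 2 is stub 2 at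
`(δ, R, η)` and stub 1, rearranged. Real proof, no `sorry`; concludes the route decl
`FluxTubeKepler.KeplerEnergyFloor` BY NAME. Sorries: exactly the two stubs.

Disproof used: none exists for this crux (`ledger crux ls stmt-AtomisticToContinuum-15222`: no
workfiles, 2026-08-17). Negatives index: no refuted statement of the summit concerns energy
identities or cell floors of this shape.
-/

namespace Summit.AtomisticToContinuum.Crystallization.Cruxes.KeplerEnergyFloor.Birth

open scoped BigOperators

/-- **Stub 1 — the Lennard-Jones scaling identity.** For every finite configuration `x` of `ℝ³`,
`interactionEnergy lennardJones x = Σ_i ((1/24)·siteEnergy (r ↦ r⁻¹²) x i − (1/12)·siteEnergy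
(r ↦ r⁻⁶) x i)`: double counting (`two_mul_interactionEnergy`) and linearity of the site energy
in the potential, with `lennardJones r = (1/12)(r⁻¹)¹² − (1/6)(r⁻¹)⁶`. The one place where the
constants `1/24, 1/12` of `FluxCellKepler` meet the tree's normalisation. True; provable now;
strictly weaker than (indeed independent of) the crux. -/
theorem stub_energyIdentity : ∀ (N : ℕ) (x : Fin N → EuclideanSpace ℝ (Fin 3)), Literature.MathematicalPhysics.StatisticalMechanics.interactionEnergy Literature.MathematicalPhysics.StatisticalMechanics.lennardJones x = ∑ i, ((1 / 24 : ℝ) * Literature.MathematicalPhysics.StatisticalMechanics.siteEnergy (fun r => (r⁻¹) ^ 12) x i - (1 / 12 : ℝ) * Literature.MathematicalPhysics.StatisticalMechanics.siteEnergy (fun r => (r⁻¹) ^ 6) x i) := by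
  sorry

/-- **Stub 2 — the τ-free cell floor from `FluxCellKepler`.** If the flux-cell Kepler inequality
holds, then one periodic configuration `P₀` floors the inverse-power cell functional on every
separated configuration, with a defect budget: for all `δ > 0`, `R > 0`, `η > 0` there is `c > 0`
such that for every injective `δ`-separated `x : Fin N → ℝ³`,
`N·e(P₀) + c·#(sites whose R-neighbourhood is not η-close to a layered set) ≤
Σ_i ((1/24)·siteEnergy (r ↦ r⁻¹²) x i − (1/12)·siteEnergy (r ↦ r⁻⁶) x i)`.
Proof idea: DOM (`Σ S₆ ≤ Σ τ`, entering with the sign `−1/12`) and KEPLER at `(δ, R, η)`; the tail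
credit `τ` and its radius `R₁` are eliminated. True given the hypothesis; provable now (M). -/
theorem stub_cellFloor : Summit.AtomisticToContinuum.Crystallization.Theses.FluxTubeKepler.FluxCellKepler → ∃ P₀ : Literature.MathematicalPhysics.StatisticalMechanics.PeriodicConfiguration 3, ∀ δ : ℝ, 0 < δ → ∀ R η : ℝ, 0 < R → 0 < η → ∃ c : ℝ, 0 < c ∧ ∀ (N : ℕ) (x : Fin N → EuclideanSpace ℝ (Fin 3)), Function.Injective x → (∀ i j, i ≠ j → δ ≤ dist (x i) (x j)) → (N : ℝ) * P₀.energyPerParticle Literature.MathematicalPhysics.StatisticalMechanics.lennardJones + c * (Nat.card {i : Fin N // ¬ ∃ a : ℝ, 47 / 50 ≤ a ∧ a ≤ 1 ∧ ∃ (A : EuclideanSpace ℝ (Fin 3) →ₗᵢ[ℝ] EuclideanSpace ℝ (Fin 3)) (s : ℤ → ℤ) (z : ℤ → ℝ), Literature.MathematicalPhysics.StatisticalMechanics.IsHaggSeq s ∧ (∀ m : ℤ, 39 / 50 * a ≤ z (m + 1) - z m ∧ z (m + 1) - z m ≤ 17 / 20 * a) ∧ let S : Set (EuclideanSpace ℝ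 (Fin 3)) := {p | ∃ m k l : ℤ, p = A (((k : ℝ) • Literature.MathematicalPhysics.StatisticalMechanics.triangularVec₁ a) + ((l : ℝ) • Literature.MathematicalPhysics.StatisticalMechanics.triangularVec₂ a) + ((Literature.MathematicalPhysics.StatisticalMechanics.haggLabel s m : ℝ) • Literature.MathematicalPhysics.StatisticalMechanics.barlowOffset a) + (z m • Literature.MathematicalPhysics.StatisticalMechanics.layerNormal 1))}; (∀ p ∈ S, ‖p‖ ≤ R → ∃ j : Fin N, dist (x j - x i) p ≤ η) ∧ (∀ j : Fin N, ‖x j - x i‖ ≤ R → ∃ p ∈ S, dist (x j - x i) p ≤ η)} : ℝ) ≤ ∑ i, ((1 / 24 : ℝ) * Literature.MathematicalPhysics.StatisticalMechanics.siteEnergy (fun r => (r⁻¹) ^ 12) x i - (1 / 12 : ℝ) * Literature.MathematicalPhysics.StatisticalMechanics.siteEnergy (fun r => (r⁻¹) ^ 6) x i) := by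
  sorry

/-- **Assembly**: stub 1 → stub 2 → the crux. Ground states are injective and `δ`-separated for
the `δ` of `LennardJonesMinimalDistance`; conjunct 1 = stub 2 at `(δ, 1, 1)` (drop the
non-negative defect term) rewritten by stub 1; conjunct 2 = stub 2 at `(δ, R, η)` rewritten by
stub 1 and rearranged. Concludes the route decl `FluxTubeKepler.KeplerEnergyFloor` by name; no
`sorry`. -/
theorem KeplerEnergyFloor_of : (∀ (N : ℕ) (x : Fin N → EuclideanSpace ℝ (Fin 3)), Literature.MathematicalPhysics.StatisticalMechanics.interactionEnergy Literature.MathematicalPhysics.StatisticalMechanics.lennardJones x = ∑ i, ((1 / 24 : ℝ) * Literature.MathematicalPhysics.StatisticalMechanics.siteEnergy (fun r => (r⁻¹) ^ 12) x i - (1 / 12 : ℝ) * Literature.MathematicalPhysics.StatisticalMechanics.siteEnergy (fun r => (r⁻¹) ^ 6) x i)) → (Summit.AtomisticToContinuum.Crystallization.Theses.FluxTubeKepler.FluxCellKepler → ∃ P₀ : Literature.MathematicalPhysics.StatisticalMechanics.PeriodicConfiguration 3, ∀ δ : ℝ, 0 < δ → ∀ R η : ℝ, 0 < R → 0 < η →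 ∃ c : ℝ, 0 < c ∧ ∀ (N : ℕ) (x : Fin N → EuclideanSpace ℝ (Fin 3)), Function.Injective x → (∀ i j, i ≠ j → δ ≤ dist (x i) (x j)) → (N : ℝ) * P₀.energyPerParticle Literature.MathematicalPhysics.StatisticalMechanics.lennardJones + c * (Nat.card {i : Fin N // ¬ ∃ a : ℝ, 47 / 50 ≤ a ∧ a ≤ 1 ∧ ∃ (A : EuclideanSpace ℝ (Fin 3) →ₗᵢ[ℝ] EuclideanSpace ℝ (Fin 3)) (s : ℤ → ℤ) (z : ℤ → ℝ), Literature.MathematicalPhysics.StatisticalMechanics.IsHaggSeq s ∧ (∀ m : ℤ, 39 / 50 * a ≤ z (m + 1) - z m ∧ z (m + 1) - z m ≤ 17 / 20 * a) ∧ let S : Set (EuclideanSpace ℝ (Fin 3)) := {p | ∃ m k l : ℤ, p = A (((k : ℝ) • Literature.MathematicalPhysics.StatisticalMechanics.triangularVec₁ a) + ((l : ℝ) • Literature.MathematicalPhysics.StatisticalMechanics.triangularVec₂ a) + ((Literature.MathematicalPhysics.StatisticalMechanics.haggLabel s m : ℝ) • Literature.MathematicalPhysics.StatisticalMechanics.barlowOffset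 a) + (z m • Literature.MathematicalPhysics.StatisticalMechanics.layerNormal 1))}; (∀ p ∈ S, ‖p‖ ≤ R → ∃ j : Fin N, dist (x j - x i) p ≤ η) ∧ (∀ j : Fin N, ‖x j - x i‖ ≤ R → ∃ p ∈ S, dist (x j - x i) p ≤ η)} : ℝ) ≤ ∑ i, ((1 / 24 : ℝ) * Literature.MathematicalPhysics.StatisticalMechanics.siteEnergy (fun r => (r⁻¹) ^ 12) x i - (1 / 12 : ℝ) * Literature.MathematicalPhysics.StatisticalMechanics.siteEnergy (fun r => (r⁻¹) ^ 6) x i)) → Summit.AtomisticToContinuum.Crystallization.Theses.FluxTubeKepler.KeplerEnergyFloor := by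
  intro hE hCell hK hmd
  obtain ⟨P₀, hP⟩ := hCell hK
  obtain ⟨δ, hδ, hsep⟩ := hmd
  refine ⟨P₀, ?_, ?_⟩
  · intro N x hx
    obtain ⟨c, hc, h⟩ := hP δ hδ 1 1 one_pos one_pos
    have h1 := (h N x hx.1 (hsep N x hx)).trans (hE N x).symm.le
    have h0 : ∀ K : ℕ,
        (N : ℝ) * P₀.energyPerParticle Literature.MathematicalPhysics.StatisticalMechanics.lennardJones + c * (K : ℝ) ≤
            Literature.MathematicalPhysics.StatisticalMechanics.interactionEnergy Literature.MathematicalPhysics.StatisticalMechanics.lennardJones x →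
          (N : ℝ) * P₀.energyPerParticle Literature.MathematicalPhysics.StatisticalMechanics.lennardJones ≤
            Literature.MathematicalPhysics.StatisticalMechanics.interactionEnergy Literature.MathematicalPhysics.StatisticalMechanics.lennardJones x := by
      intro K hK
      have hcK : 0 ≤ c * (K : ℝ) := mul_nonneg hc.le (Nat.cast_nonneg K)
      linarith
    exact h0 _ h1
  · intro R η hR hη
    obtain ⟨c, hc, h⟩ := hP δ hδ R η hR hη
    refine ⟨c, hc, fun N x hx => ?_⟩
    have h1 := (h N x hx.1 (hsep N x hx)).trans (hE N x).symm.le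
    exact le_sub_iff_add_le'.2 h1

/-- The assembly instantiated with the two stubs: the crux, modulo exactly the two `sorry`s
(by-name, hypothesis-free target of `ledger skeleton check`). -/
theorem KeplerEnergyFloor_proof : Summit.AtomisticToContinuum.Crystallization.Theses.FluxTubeKepler.KeplerEnergyFloor :=
  KeplerEnergyFloor_of stub_energyIdentity stub_cellFloor

end Summit.AtomisticToContinuum.Crystallization.Cruxes.KeplerEnergyFloor.Birth
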